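import Literature.RingTheory.KTheory.MilnorKStiefelWhitneyHom
import Mathlib.Data.Nat.Choose.Sum
import Mathlib.Algebra.BigOperators.Group.Finset.Powerset
import HarnessLib

/-!
# LEMMA 3.2: the Stiefel–Whitney invariant of a product `ξ = ((a₁) − (1))⋯((aₙ) − (1))` is
# `(1 + l(a₁)⋯l(aₙ)l(−1)^{t−n})^{±1}`, `t = 2ⁿ⁻¹` (Milnor, *Algebraic K-theory and quadratic forms*, Invent. Math. 9
# (1970), §3), through an identity in commutative rings of characteristic `2`

Family `hodge`, lane `lit-hodgefound` (foundations library; seat `lit-hodgefound-p27`, generation 41, row g41-#3);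
topic `RingTheory/KTheory`.  Sequel of `MilnorKWittGrothendieckRing` (g41-#1: `Ŵ(F)`, `gen`, `gen_prod`) and
`MilnorKStiefelWhitneyHom` (g41-#2: `KC F = k_*F` commutative, `klc a = l(a)`, `swUnit`, `swHom`, `swSeries`, `swCoeff`).
PROVED THEOREMS and definitions with bodies; no named fact, no instance, no notation, 0 `sorry`, net debt 0 (D-0026).

## The source, verbatim

J. Milnor, *Algebraic K-theory and quadratic forms*, Invent. Math. 9 (1970) 318–344 (held `paper:doi-10-1007-bf01425486`;
bib key `Milnor1970`), §3 (p0012 L29 – p0013 L29): «Next consider a generator (5) ξ = ((a₁) − (1))((a₂) − (1))⋯((aₙ) − (1))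
of the ideal ÎⁿF. Let t = 2ⁿ⁻¹. LEMMA 3.2. The Stiefel-Whitney invariant w of such a product ξ is equal to either
1 + l(a₁)⋯l(aₙ)l(−1)^{t−n} or (1 + l(a₁)⋯l(aₙ)l(−1)^{t−n})⁻¹ according as n is odd or even. *Proof.* Multiplying out
the formula (5), we obtain ξ = Σ ±(a₁^{ε₁}⋯aₙ^{εₙ}), to be summed as ε₁, …, εₙ range over 0 and 1. Here and subsequently,
± stands for the sign (−1)^{ε₁+⋯+εₙ+n}. Therefore w(ξ) = ∏ (1 + ε₁l(a₁) + ⋯ + εₙl(aₙ))^{±1}. Consider the corresponding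
product (6) ∏ (1 + ε₁x₁ + ⋯ + εₙxₙ)^{±1} in the ring of formal power series with mod 2 coefficients in n indeterminates.
If we substitute 0 for some xᵢ, then evidently this product becomes 1. Hence the product (6) must be equal to
1 + x₁⋯xₙ f(x₁, …, xₙ) for some formal power series f. Therefore w(ξ) = 1 + l(a₁)⋯l(aₙ) f(l(a₁), …, l(aₙ))
= 1 + l(a₁)⋯l(aₙ) f(l(−1), …, l(−1)); using §1.2. To compute the power series f(l(−1), …, l(−1)) it suffices to
substitute x₁ = ⋯ = xₙ = x in (6), so as to compute f(x, …, x). Evidently the product reduces to either (1 + x)^t or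
(1 + x)^{−t} according as n is odd or even; where t = 2ⁿ⁻¹. For n odd it follows that 1 + xⁿ f(x, …, x) = (1 + x)^t =
1 + x^t, so that f(x, …, x) = x^{t−n}; and a similar computation can be carried out for n even. This completes the
proof.»

## What is formalised, and the road taken

* **LEMMA 3.2, the expansion step** (verbatim): `prod_gen_sub_one_eq_sum` («ξ = Σ ±(a₁^{ε₁}⋯aₙ^{εₙ})», the sum over the
  subsets `S ⊆ s` with sign `(−1)^{#s + #S}`) and **`toMul_swHom_prod_gen_sub_one`**
  («w(ξ) = ∏ (1 + ε₁l(a₁) + ⋯ + εₙl(aₙ))^{±1}», as the alternating product `SWIdentity.subsetProd` of the units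
  `1 + Σ_{i∈S} l(aᵢ)X`).
* **The closed form, by a different (shorter in Lean) road than Milnor's `n`-variable power series**: the ABSTRACT
  IDENTITY **`SWIdentity.subsetProd_eq`** — in any commutative ring `R` with `2 = 0`, for an ideal `J` with `1 + J ⊆ Rˣ`,
  elements `yᵢ ∈ J` (`i ∈ s`, `s` a nonempty finset) and `δ ∈ R` with `yᵢ² = yᵢδ` (Milnor's «using §1.2», `l(a)² = l(a)l(−1)`):
  `∏_{S ⊆ s} (1 + Σ_{i∈S} yᵢ)^{(−1)^{#s+#S}} = (1 + (∏ yᵢ) δ^{2^{#s−1} − #s})^{(−1)^{#s+1}}`, proved by induction on `s`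
  (adjoin `z`: factor `1 + z + y_S = (1 + z)(1 + c·y_S)` with `c = (1+z)⁻¹`, the powers of `1 + z` cancel since
  `Σ_S (−1)^{#S} = 0`, the rescaled family `c·yᵢ` satisfies the hypothesis with `cδ`, and the two closed forms are
  compared through the Frobenius identity `(1 + z)^t = 1 + z^t` (`t = 2^{#s−1}`), `z^t = zδ^{t−1}` and
  `M(z^t + m) = 2Mδ^t = 0`).  Milnor's substitution argument proves the same polynomial identity; it is cited, not
  transcribed.
* **LEMMA 3.2** in `k_ΠF ⊂ PowerSeries (KC F)`: with `t = 2^{#s−1}` and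
  `topCoeff s a = l(a₁)⋯l(aₙ)·l(−1)^{t−n} ∈ k_tF` (`topCoeff_mem_kRangeC`):
  **`swSeries_prod_gen_sub_one_of_odd : w(ξ) = 1 + l(a₁)⋯l(aₙ)l(−1)^{t−n}X^t`** (`n` odd) and
  **`swSeries_prod_gen_sub_one_mul_of_even : w(ξ)·(1 + l(a₁)⋯l(aₙ)l(−1)^{t−n}X^t) = 1`** (`n` even, `n ≥ 1`), the
  unit form `toMul_swHom_prod_gen_sub_one_eq`, and the `Fin n`-indexed versions
  (`swSeries_finProd_gen_sub_one_of_odd` / `_mul_of_even`) for the ordered products `((a₁) − (1))⋯((aₙ) − (1))` of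
  `MilnorKWittGrothendieckRing.prodGens`.
* Not here: Corollary 3.3 (`w₁, …, w_{t−1}` annihilate `Îⁿ`, `w_t : Îⁿ/Îⁿ⁺¹ → k_tF`) and Theorem 4.1's bijectivity —
  row g41-#4.

## References

* [Milnor1970] J. Milnor, *Algebraic K-theory and quadratic forms*, Invent. Math. 9 (1970) 318–344 — §3, the generator
  (5) and Lemma 3.2 with its proof (p0012 L29 – p0013 L29); §1 Lemma 1.2 `l(a)² = l(a)l(−1)` (p0002 L36–L37).

Provenance: lane `lit-hodgefound`, seat `lit-hodgefound-p27` gen 41 (agent `literature-prover-lit-hodgefound-p27-g41-0`),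
row g41-#3.
-/

set_option autoImplicit false

noncomputable section

namespace Literature.RingTheory.KTheory

open Function Finset PowerSeries

/-! ### The abstract identity behind LEMMA 3.2 (commutative rings with `2 = 0`) -/

namespace SWIdentity

variable {R : Type*} [CommRing R]

/-- The unit `1 + r` of `R` (a total function of `r`: the unit with value `1 + r` when `1 + r` is a unit, else `1`).
[cite: Milnor1970, §3 proof of Lemma 3.2 «w(ξ) = ∏ (1 + ε₁l(a₁) + ⋯ + εₙl(aₙ))^{±1}» (p0012 L47–L49)] -/
def oneAddUnit (r : R) : Rˣ := by
  classical
  exact if h : IsUnit (1 + r) then h.unit else 1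

/-- `oneAddUnit r = 1 + r` when `1 + r` is a unit. [cite: Milnor1970, §3 proof of Lemma 3.2 (p0012 L47–L49)] -/
theorem val_oneAddUnit {r : R} (h : IsUnit (1 + r)) : (oneAddUnit r : R) = 1 + r := by
  classical
  rw [oneAddUnit, dif_pos h, IsUnit.unit_spec]

/-- `oneAddUnit 0 = 1`. [cite: Milnor1970, §3 proof of Lemma 3.2 (p0012 L47–L49)] -/
theorem oneAddUnit_zero : oneAddUnit (0 : R) = 1 :=
  Units.ext (by rw [val_oneAddUnit (by rw [add_zero]; exact isUnit_one), add_zero, Units.val_one])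

/-- **The alternating product `∏_{S ⊆ s} (1 + Σ_{i ∈ S} yᵢ)^{(−1)^{#s + #S}}`** over all subsets of `s` («∏ (1 + ε₁l(a₁) +
⋯ + εₙl(aₙ))^{±1}», «± stands for the sign (−1)^{ε₁+⋯+εₙ+n}»). [cite: Milnor1970, §3 proof of Lemma 3.2 (p0012 L44–L49)] -/
def subsetProd {ι : Type*} (s : Finset ι) (y : ι → R) : Rˣ :=
  ∏ S ∈ s.powerset, oneAddUnit (∑ i ∈ S, y i) ^ ((-1 : ℤ) ^ (s.card + S.card))

/-- `subsetProd` unfolded. [cite: Milnor1970, §3 proof of Lemma 3.2 (p0012 L44–L49)] -/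
theorem subsetProd_def {ι : Type*} (s : Finset ι) (y : ι → R) :
    subsetProd s y = ∏ S ∈ s.powerset, oneAddUnit (∑ i ∈ S, y i) ^ ((-1 : ℤ) ^ (s.card + S.card)) := rfl

/-- **Milnor's closed form `y₁⋯yₙ · δ^{2ⁿ⁻¹ − n}`** (`l(a₁)⋯l(aₙ)l(−1)^{t−n}`, `t = 2ⁿ⁻¹`). [cite: Milnor1970, §3 Lemma 3.2 (p0012 L35–L43)] -/
def topTerm {ι : Type*} (s : Finset ι) (y : ι → R) (δ : R) : R := (∏ i ∈ s, y i) * δ ^ (2 ^ (s.card - 1) - s.card)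

/-- `topTerm` unfolded. [cite: Milnor1970, §3 Lemma 3.2 (p0012 L35–L43)] -/
theorem topTerm_def {ι : Type*} (s : Finset ι) (y : ι → R) (δ : R) :
    topTerm s y δ = (∏ i ∈ s, y i) * δ ^ (2 ^ (s.card - 1) - s.card) := rfl

/-- **Frobenius in characteristic `2`: `(1 + x)^(2^j) = 1 + x^(2^j)`** («(1 + x)^t = 1 + x^t»). [cite: Milnor1970, §3 proof of Lemma 3.2 «1 + xⁿf(x, …, x) = (1 + x)^t = 1 + x^t» (p0013 L21–L23)] -/
theorem one_add_pow_two_pow (h2 : (2 : R) = 0) (x : R) (j : ℕ) : (1 + x) ^ 2 ^ j = 1 + x ^ 2 ^ j := by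
  induction j with
  | zero => rw [pow_zero, pow_one, pow_one]
  | succ j ih =>
    rw [pow_succ, pow_mul, ih, pow_mul]
    have : (1 + x ^ 2 ^ j) ^ 2 = 1 + (x ^ 2 ^ j) ^ 2 + 2 * x ^ 2 ^ j := by ring
    rw [this, h2, zero_mul, add_zero]

/-- `x² = xδ ⇒ x^(j+1) = x δ^j` («using §1.2», `l(a)² = l(a)l(−1)`). [cite: Milnor1970, §3 proof of Lemma 3.2 «= 1 + l(a₁)⋯l(aₙ) f(l(−1), …, l(−1)); using §1.2» (p0013 L16–L18)] -/
theorem pow_succ_eq_mul_pow {x δ : R} (hx : x * x = x * δ) (j : ℕ) : x ^ (j + 1) = x * δ ^ j := by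
  induction j with
  | zero => rw [zero_add, pow_one, pow_zero, mul_one]
  | succ j ih => rw [pow_succ, ih, mul_assoc, mul_comm (δ ^ j) x, ← mul_assoc, hx, mul_assoc, ← pow_succ']

/-- `∏ u^{f S} = u^{Σ f S}` in a commutative group. [folklore] -/
private theorem prod_zpow_eq_zpow_sum {α : Type*} (T : Finset α) (u : Rˣ) (f : α → ℤ) :
    ∏ S ∈ T, u ^ f S = u ^ (∑ S ∈ T, f S) := by
  classical
  induction T using Finset.induction_on with
  | empty => rw [prod_empty, sum_empty, zpow_zero]
  | insert a T ha ih => rw [prod_insert ha, sum_insert ha, ih, zpow_add]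

/-- `Σ_{S ⊆ s} (−1)^{#s + #S} = 0` for nonempty `s` («if we substitute 0 for some xᵢ, then evidently this product
becomes 1»: the exponents cancel in pairs). [cite: Milnor1970, §3 proof of Lemma 3.2 (p0013 L12–L13)] -/
theorem sum_powerset_neg_one_pow {ι : Type*} (s : Finset ι) (hs : s.Nonempty) :
    (∑ S ∈ s.powerset, (-1 : ℤ) ^ (s.card + S.card)) = 0 := by
  have h := Finset.sum_powerset_neg_one_pow_card_of_nonempty hs
  calc (∑ S ∈ s.powerset, (-1 : ℤ) ^ (s.card + S.card)) = (-1) ^ s.card * ∑ S ∈ s.powerset, (-1 : ℤ) ^ S.card := by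
        rw [Finset.mul_sum]; exact Finset.sum_congr rfl fun S _ => pow_add _ _ _
    _ = 0 := by rw [h, mul_zero]

/-- `(∏ yᵢ)² = (∏ yᵢ) δ^{#s}` from `yᵢ² = yᵢδ`. [cite: Milnor1970, §3 proof of Lemma 3.2 «using §1.2» (p0013 L16–L18)] -/
theorem prod_mul_prod_eq {ι : Type*} (s : Finset ι) (y : ι → R) (δ : R) (hy : ∀ i ∈ s, y i * y i = y i * δ) :
    (∏ i ∈ s, y i) * ∏ i ∈ s, y i = (∏ i ∈ s, y i) * δ ^ s.card := by
  rw [← prod_mul_distrib, ← prod_const, ← prod_mul_distrib]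
  exact prod_congr rfl fun i hi => hy i hi

/-- `k ≤ 2^(k − 1)` for `k ≥ 1` (`t − n ≥ 0`). [cite: Milnor1970, §3 Lemma 3.2 «Let t = 2ⁿ⁻¹» (p0012 L34)] -/
theorem le_two_pow_pred (k : ℕ) (hk : 1 ≤ k) : k ≤ 2 ^ (k - 1) := by
  obtain ⟨j, rfl⟩ : ∃ j, k = j + 1 := ⟨k - 1, by omega⟩
  rw [Nat.add_sub_cancel]
  exact Nat.lt_two_pow_self

/-- **The abstract form of LEMMA 3.2.**  In a commutative ring with `2 = 0`, let `J` be an ideal with `1 + J ⊆ Rˣ`, let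
`yᵢ ∈ J` (`i ∈ s`, `s` nonempty) and `δ` satisfy `yᵢ² = yᵢδ`.  Then
`∏_{S ⊆ s} (1 + Σ_{i∈S} yᵢ)^{(−1)^{#s+#S}} = (1 + (∏ yᵢ)·δ^{2^{#s−1} − #s})^{(−1)^{#s+1}}`
(«the product reduces to either (1 + x)^t or (1 + x)^{−t} according as n is odd or even»).  Proof by induction on `s`
(see the module docstring), replacing Milnor's substitution argument in `𝔽₂[[x₁, …, xₙ]]`.
[cite: Milnor1970, §3 Lemma 3.2 and its proof (p0012 L35 – p0013 L29)] -/
theorem subsetProd_eq {ι : Type*} [DecidableEq ι] (h2 : (2 : R) = 0) (J : Ideal R) (hJ : ∀ r ∈ J, IsUnit (1 + r))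
    (s : Finset ι) (hs : s.Nonempty) (y : ι → R) (δ : R) (hyJ : ∀ i ∈ s, y i ∈ J)
    (hy : ∀ i ∈ s, y i * y i = y i * δ) :
    subsetProd s y = oneAddUnit (topTerm s y δ) ^ ((-1 : ℤ) ^ (s.card + 1)) := by
  induction s using Finset.induction_on generalizing y δ with
  | empty => exact absurd hs Finset.not_nonempty_empty
  | insert a s ha ih =>
    have hsumJ : ∀ S ∈ s.powerset, (∑ i ∈ S, y i) ∈ J := fun S hS =>
      J.sum_mem fun i hi => hyJ i (mem_insert_of_mem (mem_powerset.1 hS hi))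
    have hz : y a ∈ J := hyJ a (mem_insert_self a s)
    by_cases hs0 : s = ∅
    · -- the base case `s = {a}`: `(1 + 0)⁻¹ (1 + y_a) = 1 + y_a δ⁰`
      subst hs0
      have e1 : subsetProd (insert a ∅) y = oneAddUnit (y a) := by
        rw [subsetProd, prod_powerset_insert ha, powerset_empty, prod_singleton, prod_singleton, sum_empty,
          oneAddUnit_zero, card_insert_of_notMem ha, card_empty, sum_insert ha, sum_empty, add_zero]
        norm_num
      have e2 : topTerm (insert a ∅) y δ = y a := by
        rw [topTerm, prod_insert ha, prod_empty, card_insert_of_notMem ha, card_empty]; norm_num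
      rw [e1, e2, card_insert_of_notMem ha, card_empty]; norm_num
    -- the inductive step: adjoin `z = y a`; `c = (1 + z)⁻¹`
    have hsne : s.Nonempty := nonempty_iff_ne_empty.2 hs0
    set z := y a with hzdef
    set c : R := (((oneAddUnit z)⁻¹ : Rˣ) : R) with hcdef
    have h1z : (oneAddUnit z : R) = 1 + z := val_oneAddUnit (hJ z hz)
    have hc : (1 + z) * c = 1 := by rw [← h1z, hcdef, Units.mul_inv]
    -- the rescaled family `y' = c·y`, with `δ' = c·δ`
    set y' : ι → R := fun i => c * y i with hy'def
    have hy'J : ∀ i ∈ s, y' i ∈ J := fun i hi => J.mul_mem_left c (hyJ i (mem_insert_of_mem hi))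
    have hy' : ∀ i ∈ s, y' i * y' i = y' i * (c * δ) := fun i hi => by
      have h := hy i (mem_insert_of_mem hi)
      calc c * y i * (c * y i) = c * c * (y i * y i) := by ring
        _ = c * c * (y i * δ) := by rw [h]
        _ = c * y i * (c * δ) := by ring
    have IH1 := ih hsne y δ (fun i hi => hyJ i (mem_insert_of_mem hi)) fun i hi => hy i (mem_insert_of_mem hi)
    have IH2 := ih hsne y' (c * δ) hy'J hy'
    -- splitting the product over the subsets of `insert a s`: `Φ(insert a s, y) = Φ(s, y)⁻¹ · Φ(s, c·y)`
    have hsplit : subsetProd (insert a s) y = (subsetProd s y)⁻¹ * subsetProd s y' := by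
      rw [subsetProd, prod_powerset_insert ha, subsetProd, subsetProd, card_insert_of_notMem ha]
      have e1 : ∏ S ∈ s.powerset, oneAddUnit (∑ i ∈ S, y i) ^ ((-1 : ℤ) ^ (s.card + 1 + S.card)) =
          (∏ S ∈ s.powerset, oneAddUnit (∑ i ∈ S, y i) ^ ((-1 : ℤ) ^ (s.card + S.card)))⁻¹ := by
        rw [← prod_inv_distrib]
        refine prod_congr rfl fun S _ => ?_
        rw [← zpow_neg, show s.card + 1 + S.card = (s.card + S.card) + 1 by ring, pow_succ, mul_neg_one]
      have e2 : ∀ S ∈ s.powerset, oneAddUnit (∑ i ∈ insert a S, y i) ^ ((-1 : ℤ) ^ (s.card + 1 + (insert a S).card)) =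
          oneAddUnit z ^ ((-1 : ℤ) ^ (s.card + S.card)) * oneAddUnit (∑ i ∈ S, y' i) ^ ((-1 : ℤ) ^ (s.card + S.card)) := by
        intro S hS
        have haS : a ∉ S := fun h => ha (mem_powerset.1 hS h)
        rw [card_insert_of_notMem haS, sum_insert haS, show s.card + 1 + (S.card + 1) = (s.card + S.card) + 2 by ring,
          pow_add, neg_one_sq, mul_one, ← mul_zpow]
        congr 1
        refine Units.ext ?_
        have hSJ : (∑ i ∈ S, y i) ∈ J := hsumJ S hS
        have hS'J : (∑ i ∈ S, y' i) ∈ J :=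
          J.sum_mem fun i hi => J.mul_mem_left c (hyJ i (mem_insert_of_mem (mem_powerset.1 hS hi)))
        rw [val_oneAddUnit (hJ _ (J.add_mem hz hSJ)), Units.val_mul, h1z, val_oneAddUnit (hJ _ hS'J), hy'def]
        simp only []
        rw [← mul_sum]
        calc 1 + (z + ∑ i ∈ S, y i) = 1 + z + ((1 + z) * c) * ∑ i ∈ S, y i := by rw [hc, one_mul, add_assoc]
          _ = (1 + z) * (1 + c * ∑ i ∈ S, y i) := by ring
      rw [e1, prod_congr rfl e2, prod_mul_distrib, prod_zpow_eq_zpow_sum, sum_powerset_neg_one_pow s hsne, zpow_zero,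
        one_mul]
    -- bookkeeping: `k = #s ≥ 1`, `t = 2^{k-1} ≥ k`, `2^{#(insert a s) − 1} = 2t`
    set k := s.card with hkdef
    have hk1 : 1 ≤ k := card_pos.2 hsne
    set t : ℕ := 2 ^ (k - 1) with htdef
    have hkt : k ≤ t := le_two_pow_pred k hk1
    have ht1 : 1 ≤ t := Nat.one_le_two_pow
    have ht2 : 2 ^ ((insert a s).card - 1) = 2 * t := by
      rw [card_insert_of_notMem ha, ← hkdef, Nat.add_sub_cancel, htdef, ← pow_succ']
      congr 1; omega
    set P := ∏ i ∈ s, y i with hPdef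
    set m := topTerm s y δ with hmdef
    have hm : m = P * δ ^ (t - k) := rfl
    have hm' : topTerm s y' (c * δ) = c ^ t * m := by
      rw [topTerm, ← hkdef, ← htdef, hm, hy'def]
      simp only []
      rw [prod_mul_distrib, prod_const, ← hkdef, mul_pow, ← hPdef]
      calc c ^ k * P * (c ^ (t - k) * δ ^ (t - k)) = c ^ (k + (t - k)) * (P * δ ^ (t - k)) := by rw [pow_add]; ring
        _ = c ^ t * (P * δ ^ (t - k)) := by rw [Nat.add_sub_cancel' hkt]
    set M := topTerm (insert a s) y δ with hMdef
    have hM : M = z * P * δ ^ (2 * t - (k + 1)) := by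
      rw [hMdef, topTerm, ht2, prod_insert ha, card_insert_of_notMem ha]
    -- `z^t = z δ^(t−1)`, `m z^t = M`, `M z^t = M δ^t`, `M m = M δ^t`
    have hza := hy a (mem_insert_self a s)
    have hzt : z ^ t = z * δ ^ (t - 1) := by
      have h := pow_succ_eq_mul_pow hza (t - 1)
      rwa [Nat.sub_add_cancel ht1] at h
    have hmz : m * z ^ t = M := by
      rw [hm, hzt, hM]
      calc P * δ ^ (t - k) * (z * δ ^ (t - 1)) = z * P * (δ ^ (t - k) * δ ^ (t - 1)) := by ring
        _ = z * P * δ ^ (2 * t - (k + 1)) := by rw [← pow_add]; congr 2; omega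
    have hMz : M * z ^ t = M * δ ^ t := by
      rw [hM, hzt]
      calc z * P * δ ^ (2 * t - (k + 1)) * (z * δ ^ (t - 1))
          = (z * z) * P * (δ ^ (2 * t - (k + 1)) * δ ^ (t - 1)) := by ring
        _ = (z * δ) * P * (δ ^ (2 * t - (k + 1)) * δ ^ (t - 1)) := by rw [hza]
        _ = z * P * δ ^ (2 * t - (k + 1)) * (δ * δ ^ (t - 1)) := by ring
        _ = z * P * δ ^ (2 * t - (k + 1)) * δ ^ t := by rw [← pow_succ' δ (t - 1), Nat.sub_add_cancel ht1]
    have hPP : P * P = P * δ ^ k := prod_mul_prod_eq s y δ fun i hi => hy i (mem_insert_of_mem hi)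
    have hMm : M * m = M * δ ^ t := by
      rw [hM, hm]
      calc z * P * δ ^ (2 * t - (k + 1)) * (P * δ ^ (t - k))
          = z * (P * P) * (δ ^ (2 * t - (k + 1)) * δ ^ (t - k)) := by ring
        _ = z * (P * δ ^ k) * (δ ^ (2 * t - (k + 1)) * δ ^ (t - k)) := by rw [hPP]
        _ = z * P * δ ^ (2 * t - (k + 1)) * (δ ^ k * δ ^ (t - k)) := by ring
        _ = z * P * δ ^ (2 * t - (k + 1)) * δ ^ t := by rw [← pow_add, Nat.add_sub_cancel' hkt]
    -- the key identity `(1 + cᵗ m)(1 + M) = 1 + m` (multiply by the unit `(1 + z)^t = 1 + z^t`)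
    have hMJ : M ∈ J := by rw [hM, mul_assoc]; exact J.mul_mem_right _ hz
    have hmJ : m ∈ J := by
      rw [hm]
      obtain ⟨i, hi⟩ := hsne
      rw [hPdef, ← mul_prod_erase s y hi, mul_assoc]
      exact J.mul_mem_right _ (hyJ i (mem_insert_of_mem hi))
    have hm'J : c ^ t * m ∈ J := J.mul_mem_left _ hmJ
    have key : (1 + c ^ t * m) * (1 + M) = 1 + m := by
      have hu : IsUnit ((1 + z) ^ t) := (hJ z hz).pow t
      refine (IsUnit.mul_right_inj hu).1 ?_
      have hfrob : (1 + z) ^ t = 1 + z ^ t := one_add_pow_two_pow h2 z (k - 1)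
      have hct : (1 + z) ^ t * c ^ t = 1 := by rw [← mul_pow, hc, one_pow]
      calc (1 + z) ^ t * ((1 + c ^ t * m) * (1 + M)) = ((1 + z) ^ t + ((1 + z) ^ t * c ^ t) * m) * (1 + M) := by ring
        _ = (1 + z ^ t + m) * (1 + M) := by rw [hct, one_mul, hfrob]
        _ = (1 + z ^ t) * (1 + m) + (M + M * z ^ t + M * m - m * z ^ t) := by ring
        _ = (1 + z ^ t) * (1 + m) + (M + M * δ ^ t + M * δ ^ t - M) := by rw [hMz, hMm, hmz]
        _ = (1 + z ^ t) * (1 + m) + 2 * (M * δ ^ t) := by ring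
        _ = (1 + z) ^ t * (1 + m) := by rw [h2, zero_mul, add_zero, hfrob]
    have hunits : oneAddUnit (c ^ t * m) * oneAddUnit M = oneAddUnit m := Units.ext (by
      rw [Units.val_mul, val_oneAddUnit (hJ _ hm'J), val_oneAddUnit (hJ _ hMJ), val_oneAddUnit (hJ _ hmJ), key])
    -- assemble
    rw [hsplit, IH1, IH2, hm', card_insert_of_notMem ha, ← hkdef, pow_succ (-1 : ℤ) (k + 1), mul_neg_one, zpow_neg,
      ← inv_zpow, ← inv_zpow, ← mul_zpow]
    congr 1
    rw [← hunits, mul_inv_rev, inv_mul_cancel_right]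

/-- The odd case: `∏_{S ⊆ s} (1 + y_S)^{±1} = 1 + y₁⋯yₙδ^{t−n}` as elements of `R` («according as n is odd»). [cite: Milnor1970, §3 Lemma 3.2 (p0012 L35–L43)] -/
theorem val_subsetProd_of_odd {ι : Type*} [DecidableEq ι] (h2 : (2 : R) = 0) (J : Ideal R)
    (hJ : ∀ r ∈ J, IsUnit (1 + r)) (s : Finset ι) (hs : Odd s.card) (y : ι → R) (δ : R) (hyJ : ∀ i ∈ s, y i ∈ J)
    (hy : ∀ i ∈ s, y i * y i = y i * δ) (hm : topTerm s y δ ∈ J) : (subsetProd s y : R) = 1 + topTerm s y δ := by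
  have hne : s.Nonempty := card_pos.1 hs.pos
  rw [subsetProd_eq h2 J hJ s hne y δ hyJ hy, Odd.add_one hs |>.neg_one_pow, zpow_one, val_oneAddUnit (hJ _ hm)]

/-- The even case: `(∏_{S ⊆ s} (1 + y_S)^{±1}) · (1 + y₁⋯yₙδ^{t−n}) = 1` («or even»). [cite: Milnor1970, §3 Lemma 3.2 (p0012 L35–L43)] -/
theorem val_subsetProd_mul_of_even {ι : Type*} [DecidableEq ι] (h2 : (2 : R) = 0) (J : Ideal R)
    (hJ : ∀ r ∈ J, IsUnit (1 + r)) (s : Finset ι) (hne : s.Nonempty) (hs : Even s.card) (y : ι → R) (δ : R)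
    (hyJ : ∀ i ∈ s, y i ∈ J) (hy : ∀ i ∈ s, y i * y i = y i * δ) (hm : topTerm s y δ ∈ J) :
    (subsetProd s y : R) * (1 + topTerm s y δ) = 1 := by
  rw [subsetProd_eq h2 J hJ s hne y δ hyJ hy, Even.add_one hs |>.neg_one_pow, zpow_neg, zpow_one,
    ← val_oneAddUnit (hJ _ hm), Units.inv_mul]

end SWIdentity

/-! ### LEMMA 3.2 in `k_ΠF` -/

section Field

variable (F : Type*) [Field F]

namespace MilnorKStar

/-- **`l(a)X ∈ k_ΠF`**: the degree-one term `εᵢ l(aᵢ)` of the factors `1 + εᵢl(aᵢ)` (the series `y = l(a)X`). [cite: Milnor1970, §3 proof of Lemma 3.2 «w(ξ) = ∏ (1 + ε₁l(a₁) + ⋯ + εₙl(aₙ))^{±1}» (p0012 L47–L49)] -/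
def lX (a : Fˣ) : PowerSeries (KC F) := C (klc F a) * X

/-- `lX` unfolded. [cite: Milnor1970, §3 proof of Lemma 3.2 (p0012 L47–L49)] -/
theorem lX_def (a : Fˣ) : lX F a = C (klc F a) * X := rfl

/-- `l(ab)X = l(a)X + l(b)X`. [cite: Milnor1970, §3 (p0010 L31)] -/
theorem lX_mul (a b : Fˣ) : lX F (a * b) = lX F a + lX F b := by rw [lX_def, klc_mul, map_add, add_mul, lX_def, lX_def]

/-- `l(1)X = 0`. [cite: Milnor1970, §3 (p0010 L31)] -/
theorem lX_one : lX F 1 = 0 := by rw [lX_def, klc_one, map_zero, zero_mul]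

/-- `a ↦ l(a)X` as a homomorphism `F• → (PowerSeries KC, +)`. [cite: Milnor1970, §3 (p0010 L31)] -/
def lXHom : Fˣ →* Multiplicative (PowerSeries (KC F)) where
  toFun a := Multiplicative.ofAdd (lX F a)
  map_one' := by rw [lX_one]; rfl
  map_mul' a b := by rw [lX_mul]; rfl

/-- `Σ_{i∈S} l(aᵢ)X = l(∏_{i∈S} aᵢ)X`. [cite: Milnor1970, §3 proof of Lemma 3.2 «1 + ε₁l(a₁) + ⋯ + εₙl(aₙ)» (p0012 L47–L49)] -/
theorem sum_lX {ι : Type*} (S : Finset ι) (a : ι → Fˣ) : ∑ i ∈ S, lX F (a i) = lX F (∏ i ∈ S, a i) := by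
  have h := map_prod (lXHom F) a S
  change Multiplicative.ofAdd (lX F (∏ i ∈ S, a i)) = ∏ i ∈ S, Multiplicative.ofAdd (lX F (a i)) at h
  rw [← ofAdd_sum] at h
  exact (Multiplicative.ofAdd.injective h).symm

/-- **«using §1.2»: `(l(a)X)² = (l(a)X)(l(−1)X)`** (`l(a)² = l(a)l(−1)`). [cite: Milnor1970, §3 proof of Lemma 3.2 (p0013 L16–L18); §1 Lemma 1.2 (p0002 L36–L37)] -/
theorem lX_mul_lX (a : Fˣ) : lX F a * lX F a = lX F a * lX F (-1) := by
  rw [lX_def, lX_def]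
  calc C (klc F a) * X * (C (klc F a) * X) = C (klc F a * klc F a) * (X * X) := by rw [map_mul]; ring
    _ = C (klc F a * klc F (-1)) * (X * X) := by rw [klc_mul_self]
    _ = C (klc F a) * X * (C (klc F (-1)) * X) := by rw [map_mul]; ring

/-- `2 = 0` in `PowerSeries KC`. [cite: Milnor1970, §3 «formal power series with mod 2 coefficients» (p0013 L12)] -/
theorem two_eq_zero_powerSeries : (2 : PowerSeries (KC F)) = 0 := by
  rw [← map_ofNat (C (R := KC F)) 2, two_eq_zero_KC, map_zero]

/-- **The ideal of series without constant term** (`1 +` it consists of units). [cite: Milnor1970, §3 Lemma 3.1 «a well defined unit in the ring k_ΠF» (p0011 L24–L25)] -/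
def constKer : Ideal (PowerSeries (KC F)) := RingHom.ker (constantCoeff (R := KC F))

/-- Membership in `constKer`. [cite: Milnor1970, §3 Lemma 3.1 (p0011 L24–L25)] -/
theorem mem_constKer_iff (φ : PowerSeries (KC F)) : φ ∈ constKer F ↔ constantCoeff φ = 0 := RingHom.mem_ker

/-- `l(a)X ∈ constKer`. [cite: Milnor1970, §3 Lemma 3.1 (p0011 L24–L25)] -/
theorem lX_mem_constKer (a : Fˣ) : lX F a ∈ constKer F := by
  rw [mem_constKer_iff, lX_def, map_mul, constantCoeff_X, mul_zero]

/-- `1 + φ` is a unit for `φ ∈ constKer`. [cite: Milnor1970, §3 Lemma 3.1 «a well defined unit» (p0011 L24–L25)] -/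
theorem isUnit_one_add_of_mem_constKer {φ : PowerSeries (KC F)} (h : φ ∈ constKer F) : IsUnit (1 + φ) := by
  rw [isUnit_iff_constantCoeff, map_add, map_one, (mem_constKer_iff F φ).1 h, add_zero]
  exact isUnit_one

/-- `w((a)) = 1 + l(a)X` is the unit `oneAddUnit (l(a)X)`. [cite: Milnor1970, §3 proof of Lemma 3.2 (p0012 L47–L49)] -/
theorem swUnit_eq_oneAddUnit (a : Fˣ) : swUnit F a = SWIdentity.oneAddUnit (lX F a) :=
  Units.ext (by rw [coe_swUnit, SWIdentity.val_oneAddUnit (isUnit_one_add_of_mem_constKer F (lX_mem_constKer F a)), lX_def])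

/-- **«Multiplying out the formula (5), we obtain ξ = Σ ±(a₁^{ε₁}⋯aₙ^{εₙ})», the sign `(−1)^{ε₁+⋯+εₙ+n}`**: in `Ŵ(F)`,
`∏_{i∈s} ((aᵢ) − (1)) = Σ_{S ⊆ s} (−1)^{#s + #S} (∏_{i∈S} aᵢ)`. [cite: Milnor1970, §3 proof of Lemma 3.2 (p0012 L44–L47)] -/
theorem prod_gen_sub_one_eq_sum {ι : Type*} [DecidableEq ι] (s : Finset ι) (a : ι → Fˣ) :
    ∏ i ∈ s, (WittGrothendieckRing.gen F (a i) - 1) =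
      ∑ S ∈ s.powerset, ((-1 : ℤ) ^ (s.card + S.card)) • WittGrothendieckRing.gen F (∏ i ∈ S, a i) := by
  have h : ∏ i ∈ s, (WittGrothendieckRing.gen F (a i) - 1) = ∏ i ∈ s, (WittGrothendieckRing.gen F (a i) + (-1)) :=
    prod_congr rfl fun i _ => sub_eq_add_neg _ _
  rw [h, prod_add]
  refine sum_congr rfl fun S hS => ?_
  rw [prod_const, card_sdiff_of_subset (mem_powerset.1 hS), WittGrothendieckRing.gen_prod, zsmul_eq_mul, mul_comm]
  congr 1
  have hle : S.card ≤ s.card := card_le_card (mem_powerset.1 hS)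
  rw [Int.cast_pow, Int.cast_neg, Int.cast_one, show s.card + S.card = (s.card - S.card) + 2 * S.card by omega, pow_add,
    pow_mul, neg_one_sq, one_pow, mul_one]

/-- **«Therefore w(ξ) = ∏ (1 + ε₁l(a₁) + ⋯ + εₙl(aₙ))^{±1}»**: the unit `w(∏((aᵢ) − (1)))` is the alternating product
`SWIdentity.subsetProd s (l(a·)X)`. [cite: Milnor1970, §3 proof of Lemma 3.2 (p0012 L44–L49)] -/
theorem toMul_swHom_prod_gen_sub_one {ι : Type*} [DecidableEq ι] (s : Finset ι) (a : ι → Fˣ) :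
    Additive.toMul (swHom F (∏ i ∈ s, (WittGrothendieckRing.gen F (a i) - 1))) =
      SWIdentity.subsetProd s (fun i => lX F (a i)) := by
  rw [prod_gen_sub_one_eq_sum, map_sum, toMul_sum, SWIdentity.subsetProd_def]
  refine prod_congr rfl fun S _ => ?_
  rw [map_zsmul, toMul_zsmul, swHom_gen, toMul_ofMul, swUnit_eq_oneAddUnit, sum_lX]

/-- **Milnor's coefficient `l(a₁)⋯l(aₙ)·l(−1)^{t−n} ∈ k_tF`**, `t = 2ⁿ⁻¹`, `n = #s`. [cite: Milnor1970, §3 Lemma 3.2 (p0012 L35–L43)] -/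
def topCoeff {ι : Type*} (s : Finset ι) (a : ι → Fˣ) : KC F := (∏ i ∈ s, klc F (a i)) * klc F (-1) ^ (2 ^ (s.card - 1) - s.card)

/-- `topCoeff` unfolded. [cite: Milnor1970, §3 Lemma 3.2 (p0012 L35–L43)] -/
theorem topCoeff_def {ι : Type*} (s : Finset ι) (a : ι → Fˣ) :
    topCoeff F s a = (∏ i ∈ s, klc F (a i)) * klc F (-1) ^ (2 ^ (s.card - 1) - s.card) := rfl

/-- `∏_{i∈s} l(aᵢ) ∈ k_{#s}F`. [cite: Milnor1970, §3 «k_*F is a graded algebra» (p0010 L30–L31)] -/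
theorem prod_klc_mem_kRangeC {ι : Type*} [DecidableEq ι] (s : Finset ι) (a : ι → Fˣ) : ∏ i ∈ s, klc F (a i) ∈ kRangeC F s.card := by
  induction s using Finset.induction_on with
  | empty => rw [prod_empty, card_empty]; exact one_mem_kRangeC_zero F
  | insert i s hi ih =>
    rw [prod_insert hi, card_insert_of_notMem hi, add_comm]
    exact mul_mem_kRangeC F (klc_mem_kRangeC_one F (a i)) ih

/-- **`l(a₁)⋯l(aₙ)l(−1)^{t−n} ∈ k_tF`.** [cite: Milnor1970, §3 Lemma 3.2 (p0012 L35–L43); Cor. 3.3 «w_t : ÎⁿF/Îⁿ⁺¹F → k_tF» (p0013 L30–L35)] -/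
theorem topCoeff_mem_kRangeC {ι : Type*} [DecidableEq ι] (s : Finset ι) (hs : s.Nonempty) (a : ι → Fˣ) :
    topCoeff F s a ∈ kRangeC F (2 ^ (s.card - 1)) := by
  have hk : s.card ≤ 2 ^ (s.card - 1) := SWIdentity.le_two_pow_pred _ (card_pos.2 hs)
  have h := mul_mem_kRangeC F (prod_klc_mem_kRangeC F s a) (pow_mem_kRangeC F (klc_mem_kRangeC_one F (-1)) (2 ^ (s.card - 1) - s.card))
  rwa [Nat.add_sub_cancel' hk] at h

/-- `∏_{i∈s} l(aᵢ)X = (∏ l(aᵢ)) X^{#s}`. [cite: Milnor1970, §3 proof of Lemma 3.2 «1 + x₁⋯xₙ f» (p0013 L13–L16)] -/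
theorem prod_lX {ι : Type*} (s : Finset ι) (a : ι → Fˣ) : ∏ i ∈ s, lX F (a i) = C (∏ i ∈ s, klc F (a i)) * X ^ s.card := by
  simp only [lX_def]
  rw [prod_mul_distrib, prod_const, map_prod]

/-- **Milnor's closed form in `k_ΠF`: `topTerm = l(a₁)⋯l(aₙ)l(−1)^{t−n} X^t`.** [cite: Milnor1970, §3 Lemma 3.2 (p0012 L35–L43)] -/
theorem topTerm_lX {ι : Type*} (s : Finset ι) (hs : s.Nonempty) (a : ι → Fˣ) :
    SWIdentity.topTerm s (fun i => lX F (a i)) (lX F (-1)) = C (topCoeff F s a) * X ^ (2 ^ (s.card - 1)) := by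
  have hk : s.card ≤ 2 ^ (s.card - 1) := SWIdentity.le_two_pow_pred _ (card_pos.2 hs)
  rw [SWIdentity.topTerm_def, prod_lX, lX_def, mul_pow, ← map_pow, topCoeff_def, map_mul]
  calc C (∏ i ∈ s, klc F (a i)) * X ^ s.card * (C (klc F (-1) ^ (2 ^ (s.card - 1) - s.card)) * X ^ (2 ^ (s.card - 1) - s.card))
      = C (∏ i ∈ s, klc F (a i)) * C (klc F (-1) ^ (2 ^ (s.card - 1) - s.card)) * (X ^ s.card * X ^ (2 ^ (s.card - 1) - s.card)) := by
        ring
    _ = C (∏ i ∈ s, klc F (a i)) * C (klc F (-1) ^ (2 ^ (s.card - 1) - s.card)) * X ^ (2 ^ (s.card - 1)) := by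
        rw [← pow_add, Nat.add_sub_cancel' hk]

/-- `topTerm ∈ constKer` (no constant term). [cite: Milnor1970, §3 Lemma 3.2 (p0012 L35–L43)] -/
theorem topTerm_lX_mem_constKer {ι : Type*} (s : Finset ι) (hs : s.Nonempty) (a : ι → Fˣ) :
    SWIdentity.topTerm s (fun i => lX F (a i)) (lX F (-1)) ∈ constKer F := by
  rw [topTerm_lX F s hs, mem_constKer_iff, map_mul, map_pow, constantCoeff_X, zero_pow (pow_ne_zero _ two_ne_zero), mul_zero]

/-- **LEMMA 3.2 (unit form): `w(∏_{i∈s}((aᵢ) − (1))) = (1 + l(a₁)⋯l(aₙ)l(−1)^{t−n}X^t)^{(−1)^{n+1}}`**, `n = #s ≥ 1`,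
`t = 2ⁿ⁻¹`. [cite: Milnor1970, §3 Lemma 3.2 (p0012 L35–L43)] -/
theorem toMul_swHom_prod_gen_sub_one_eq {ι : Type*} [DecidableEq ι] (s : Finset ι) (hs : s.Nonempty) (a : ι → Fˣ) :
    Additive.toMul (swHom F (∏ i ∈ s, (WittGrothendieckRing.gen F (a i) - 1))) =
      SWIdentity.oneAddUnit (C (topCoeff F s a) * X ^ (2 ^ (s.card - 1))) ^ ((-1 : ℤ) ^ (s.card + 1)) := by
  rw [toMul_swHom_prod_gen_sub_one, ← topTerm_lX F s hs,
    SWIdentity.subsetProd_eq (two_eq_zero_powerSeries F) (constKer F) (fun r hr => isUnit_one_add_of_mem_constKer F hr) s hs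
      _ (lX F (-1)) (fun i _ => lX_mem_constKer F (a i)) (fun i _ => lX_mul_lX F (a i))]

/-- **LEMMA 3.2, `n` odd: `w(ξ) = 1 + l(a₁)⋯l(aₙ)l(−1)^{t−n}`** (as the series `1 + l(a₁)⋯l(aₙ)l(−1)^{t−n}X^t` of `k_ΠF`).
[cite: Milnor1970, §3 Lemma 3.2 «equal to […] 1 + l(a₁)⋯l(aₙ)l(−1)^{t−n} […] according as n is odd» (p0012 L35–L43)] -/
theorem swSeries_prod_gen_sub_one_of_odd {ι : Type*} [DecidableEq ι] (s : Finset ι) (hs : Odd s.card) (a : ι → Fˣ) :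
    swSeries F (∏ i ∈ s, (WittGrothendieckRing.gen F (a i) - 1)) = 1 + C (topCoeff F s a) * X ^ (2 ^ (s.card - 1)) := by
  have hne : s.Nonempty := card_pos.1 hs.pos
  rw [swSeries_def, toMul_swHom_prod_gen_sub_one F, ← topTerm_lX F s hne]
  exact SWIdentity.val_subsetProd_of_odd (two_eq_zero_powerSeries F) (constKer F)
    (fun r hr => isUnit_one_add_of_mem_constKer F hr) s hs _ (lX F (-1)) (fun i _ => lX_mem_constKer F (a i))
    (fun i _ => lX_mul_lX F (a i)) (topTerm_lX_mem_constKer F s hne a)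

/-- **LEMMA 3.2, `n` even (`n ≥ 1`): `w(ξ) = (1 + l(a₁)⋯l(aₙ)l(−1)^{t−n})⁻¹`**, i.e. `w(ξ)·(1 + l(a₁)⋯l(aₙ)l(−1)^{t−n}X^t) = 1`.
[cite: Milnor1970, §3 Lemma 3.2 «or (1 + l(a₁)⋯l(aₙ)l(−1)^{t−n})⁻¹ according as n is […] even» (p0012 L35–L43)] -/
theorem swSeries_prod_gen_sub_one_mul_of_even {ι : Type*} [DecidableEq ι] (s : Finset ι) (hne : s.Nonempty)
    (hs : Even s.card) (a : ι → Fˣ) :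
    swSeries F (∏ i ∈ s, (WittGrothendieckRing.gen F (a i) - 1)) * (1 + C (topCoeff F s a) * X ^ (2 ^ (s.card - 1))) = 1 := by
  rw [swSeries_def, toMul_swHom_prod_gen_sub_one F, ← topTerm_lX F s hne]
  exact SWIdentity.val_subsetProd_mul_of_even (two_eq_zero_powerSeries F) (constKer F)
    (fun r hr => isUnit_one_add_of_mem_constKer F hr) s hne hs _ (lX F (-1)) (fun i _ => lX_mem_constKer F (a i))
    (fun i _ => lX_mul_lX F (a i)) (topTerm_lX_mem_constKer F s hne a)

/-- The even case as an inverse series: `w(ξ) = invOfUnit (1 + l(a₁)⋯l(aₙ)l(−1)^{t−n}X^t) 1`. [cite: Milnor1970, §3 Lemma 3.2 (p0012 L35–L43)] -/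
theorem swSeries_prod_gen_sub_one_of_even {ι : Type*} [DecidableEq ι] (s : Finset ι) (hne : s.Nonempty)
    (hs : Even s.card) (a : ι → Fˣ) :
    swSeries F (∏ i ∈ s, (WittGrothendieckRing.gen F (a i) - 1)) = invOfUnit (1 + C (topCoeff F s a) * X ^ (2 ^ (s.card - 1))) 1 := by
  set φ := 1 + C (topCoeff F s a) * X ^ (2 ^ (s.card - 1)) with hφ
  have h1 := swSeries_prod_gen_sub_one_mul_of_even F s hne hs a
  rw [← hφ] at h1
  have h2 : φ * invOfUnit φ 1 = 1 := mul_invOfUnit φ 1 (by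
    rw [hφ, map_add, map_one, map_mul, map_pow, constantCoeff_X, zero_pow (pow_ne_zero _ two_ne_zero), mul_zero, add_zero,
      Units.val_one])
  calc swSeries F (∏ i ∈ s, (WittGrothendieckRing.gen F (a i) - 1))
      = swSeries F (∏ i ∈ s, (WittGrothendieckRing.gen F (a i) - 1)) * (φ * invOfUnit φ 1) := by rw [h2, mul_one]
    _ = invOfUnit φ 1 := by rw [← mul_assoc, h1, one_mul]

/-! ### the ordered products `((a₁) − (1))⋯((aₙ) − (1))`, `a : Fin n → F•` -/

/-- The ordered product of `MilnorKWittGrothendieckRing.prodGens` is the product over `Fin n`. [cite: Milnor1970, §3 the generator (5) (p0012 L29–L34)] -/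
theorem listProd_gen_sub_one_eq_prod {n : ℕ} (a : Fin n → Fˣ) :
    (List.ofFn fun j => WittGrothendieckRing.gen F (a j) - 1).prod = ∏ j, (WittGrothendieckRing.gen F (a j) - 1) := by
  rw [List.prod_ofFn]

/-- `topCoeff` over `Fin n`: `l(a₁)⋯l(aₙ)l(−1)^{t−n}` with the ordered product. [cite: Milnor1970, §3 Lemma 3.2 (p0012 L35–L43)] -/
theorem topCoeff_univ_fin {n : ℕ} (a : Fin n → Fˣ) :
    topCoeff F (univ : Finset (Fin n)) a = (List.ofFn fun j => klc F (a j)).prod * klc F (-1) ^ (2 ^ (n - 1) - n) := by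
  rw [topCoeff_def, card_univ, Fintype.card_fin, List.prod_ofFn]

/-- **LEMMA 3.2 for the generator `ξ = ((a₁) − (1))⋯((aₙ) − (1))` of `Îⁿ`, `n` odd:
`w(ξ) = 1 + l(a₁)⋯l(aₙ)l(−1)^{t−n}X^t`.** [cite: Milnor1970, §3 Lemma 3.2 (p0012 L29–L43)] -/
theorem swSeries_finProd_gen_sub_one_of_odd {n : ℕ} (hn : Odd n) (a : Fin n → Fˣ) :
    swSeries F (List.ofFn fun j => WittGrothendieckRing.gen F (a j) - 1).prod =
      1 + C ((List.ofFn fun j => klc F (a j)).prod * klc F (-1) ^ (2 ^ (n - 1) - n)) * X ^ (2 ^ (n - 1)) := by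
  have h := swSeries_prod_gen_sub_one_of_odd F (univ : Finset (Fin n)) (by rwa [card_univ, Fintype.card_fin]) a
  rwa [← listProd_gen_sub_one_eq_prod, topCoeff_univ_fin, card_univ, Fintype.card_fin] at h

/-- **LEMMA 3.2 for the generator `ξ = ((a₁) − (1))⋯((aₙ) − (1))` of `Îⁿ`, `n ≥ 1` even:
`w(ξ)·(1 + l(a₁)⋯l(aₙ)l(−1)^{t−n}X^t) = 1`.** [cite: Milnor1970, §3 Lemma 3.2 (p0012 L29–L43)] -/
theorem swSeries_finProd_gen_sub_one_mul_of_even {n : ℕ} (hn0 : 0 < n) (hn : Even n) (a : Fin n → Fˣ) :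
    swSeries F (List.ofFn fun j => WittGrothendieckRing.gen F (a j) - 1).prod *
      (1 + C ((List.ofFn fun j => klc F (a j)).prod * klc F (-1) ^ (2 ^ (n - 1) - n)) * X ^ (2 ^ (n - 1))) = 1 := by
  have hne : (univ : Finset (Fin n)).Nonempty := univ_nonempty_iff.2 ⟨⟨0, hn0⟩⟩
  have h := swSeries_prod_gen_sub_one_mul_of_even F (univ : Finset (Fin n)) hne (by rwa [card_univ, Fintype.card_fin]) a
  rwa [← listProd_gen_sub_one_eq_prod, topCoeff_univ_fin, card_univ, Fintype.card_fin] at h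

/-- The coefficient `l(a₁)⋯l(aₙ)l(−1)^{t−n}` of the ordered product lies in `k_tF`. [cite: Milnor1970, §3 Cor. 3.3 «w_t : ÎⁿF/Îⁿ⁺¹F → k_tF» (p0013 L30–L35)] -/
theorem listProd_klc_mul_pow_mem_kRangeC {n : ℕ} (hn0 : 0 < n) (a : Fin n → Fˣ) :
    (List.ofFn fun j => klc F (a j)).prod * klc F (-1) ^ (2 ^ (n - 1) - n) ∈ kRangeC F (2 ^ (n - 1)) := by
  have hne : (univ : Finset (Fin n)).Nonempty := univ_nonempty_iff.2 ⟨⟨0, hn0⟩⟩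
  have h := topCoeff_mem_kRangeC F (univ : Finset (Fin n)) hne a
  rwa [topCoeff_univ_fin, card_univ, Fintype.card_fin] at h

end MilnorKStar

end Field

end Literature.RingTheory.KTheory

end
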